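import Summits.HodgeConjecture.HodgeConjecture.Theorems.F0P6aCanonicalFrobeniusIdealCounts   -- ★ LA3-p03 p847936: valuation table (A5)(A2)(A6), `count_finset_prod_asIdeal`
import HarnessLib

/-!
# Banal bridges for the canonical Frobenius twist ideal: from the valuation table to the `(rL)` block hypotheses (crux hLiu418 `--supports`; L3 ARITHMETIC road, organ #4)

Cell `hodgecm-mathlib` (D-0151), P6 «MOD programme», crux `stmt-HodgeConjecture-24832` (hLiu418), line L3 (`stub_FROB`), LA3-plan DEAL v2 (3) ARITHMETIC road,
feeding LEAD «M-57c» row 38 (`frobKernel_banal`, P-side organ LA4-p04 «BANAL BLOCK FROBENIUS KERNEL», census 02:22:28Z §4: its two corollaries take the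
`𝔞`-hypotheses (ét) `𝔞 ⊔ 𝔭_u = ⊤` and (mult) `∀ n, 𝔞 ⊔ 𝔭_u^n = (p^f) ⊔ 𝔭_u^n`).  THEOREMS ONLY (no definition, no instance, no notation, no named fact, no `sorry`).
HC_CM is proved only modulo the 7 printed citations (2 remaining named inputs hLiu418 24832, h413 24833) until rung 0 closes.

TOKEN (as in ★ p847883 ∕ p847936): `𝔞_can(m, τR, w) := ∏ τ ∈ univ.filter (m τ ≠ 0 ∧ ker (residue ∘ τR τ) ≠ 𝔭_{c•w}), ker (residue ∘ τR τ)`.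
* §0 GENERIC (any Dedekind `B`): `pow_sup_eq_pow_sup_of_count_eq` — two nonzero ideals with the same exponent at `𝔭_v` have the same `𝔭_v^n ⊔ ·` for every `n`
  (Mathlib `Ideal.irreducible_pow_sup`: `𝔭^n ⊔ I = 𝔭^{min(ord_𝔭 I, n)}`);
* §1 THE NORM IDEAL (`F ∕ ℚ` Galois): `count_span_absNorm_eq_card_filter_smul` — `ord_u (N𝔭_w) = #{g : 𝔭_{g•w} = 𝔭_u}` (★ C2-arith `∏_{g} 𝔭_{g•w} = (N𝔭_w)` + §0 of
  ★ p847936), and the torsor count `card_filter_ker_eq_eq_card_filter_smul` — `#{τ : τ ↦ u} = #{g : 𝔭_{g•w} = 𝔭_u}`;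
* §2 (ÉTALE BRIDGE) if every embedding inducing `u ≠ c•w` has `m = 0` then `𝔞_can ⊔ 𝔭_u^n = ⊤` (`prod_filter_ker_sup_pow_eq_top_of_forall_eq_zero`);
* §3 (MULTIPLICATIVE BRIDGE) if every embedding inducing `u ≠ c•w` has `m ≠ 0` then `ord_u 𝔞_can = ord_u (N𝔭_w)` and
  `∀ n, 𝔞_can ⊔ 𝔭_u^n = (N𝔭_w) ⊔ 𝔭_u^n` (`count_prod_filter_ker_eq_count_span_absNorm_of_forall_ne_zero`, `prod_filter_ker_sup_pow_eq_of_forall_ne_zero`);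
  the `w`-block instance needs no signature hypothesis beyond `hpair`∕`hcount` (`prod_filter_ker_sup_pow_self_eq`).
With the spine՚s `hfDeg` (`N𝔭_{c•w} = p^f`, = `N𝔭_w` by ★ `card_quotient_smul`) the right-hand sides read `(p^f) ⊔ 𝔭_u^n` — exactly LA4-p04՚s (mult) hypothesis.
[cite: Shimura1998, §13.1 Thm. 1 (pp. 97–99) and (7)] [cite: CasselsFrohlichANT1967, Ch. VII §1.1 and Prop. 1.2 (ii)] [cite: MilneANT2008, Thm. 3.7 (p. 42), Rem. 3.12 (p. 43)]
-/

set_option autoImplicit false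
set_option linter.dupNamespace false  -- `Summit.HodgeConjecture.HodgeConjecture.…` BY DESIGN (D-0017)

noncomputable section

open NumberField IsDedekindDomain IsLocalRing
open scoped Pointwise
open Literature.NumberTheory.GaloisRepresentations (closureValuationSubring)
open Literature.NumberTheory.Automorphic
open Summit.HodgeConjecture.HodgeConjecture.Theorems.F0P6aKottwitzCountAtSplitPlace
open Summit.HodgeConjecture.HodgeConjecture.Theorems.F0P6aEmbeddingTorsorPlaces
open Summit.HodgeConjecture.HodgeConjecture.Theorems.F0P6aCanonicalFrobeniusIdealRows
open Summit.HodgeConjecture.HodgeConjecture.Theorems.F0P6aCanonicalFrobeniusIdealCounts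

namespace Summit.HodgeConjecture.HodgeConjecture.Theorems.F0P6aCanonicalFrobeniusIdealBanalBridges

/-! ### §0 Same exponent at `𝔭_v` ⇒ same `𝔭_v^n ⊔ ·` -/

section Dedekind

variable {B : Type*} [CommRing B] [IsDedekindDomain B]

/-- **Two nonzero ideals with the same exponent at `𝔭_v` have the same g.c.d. with every power `𝔭_v^n`**: `𝔭_v^n ⊔ I = 𝔭_v^{min(ord_v I, n)}` (Mathlib
`Ideal.irreducible_pow_sup`, exponents via `Ideal.count_associates_factors_eq`). [cite: MilneANT2008, Thm. 3.7 (p. 42), Rem. 3.12 (p. 43)] -/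
theorem pow_sup_eq_pow_sup_of_count_eq (v : HeightOneSpectrum B) {I I' : Ideal B} (hI : I ≠ ⊥) (hI' : I' ≠ ⊥)
    (h : (Associates.mk v.asIdeal).count (Associates.mk I).factors = (Associates.mk v.asIdeal).count (Associates.mk I').factors) (n : ℕ) :
    v.asIdeal ^ n ⊔ I = v.asIdeal ^ n ⊔ I' := by
  classical
  rw [Ideal.irreducible_pow_sup hI v.irreducible, Ideal.irreducible_pow_sup hI' v.irreducible,
    ← Ideal.count_associates_factors_eq hI v.isPrime v.ne_bot, ← Ideal.count_associates_factors_eq hI' v.isPrime v.ne_bot, h]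

/-- `𝔭_v^n ⊔ I = ⊤` when `ord_v I = 0` (`I ≠ 0`). [cite: MilneANT2008, Rem. 3.12 (p. 43)] -/
theorem pow_sup_eq_top_of_count_eq_zero (v : HeightOneSpectrum B) {I : Ideal B} (hI : I ≠ ⊥)
    (h : (Associates.mk v.asIdeal).count (Associates.mk I).factors = 0) (n : ℕ) : v.asIdeal ^ n ⊔ I = ⊤ := by
  classical
  rw [Ideal.irreducible_pow_sup hI v.irreducible, ← Ideal.count_associates_factors_eq hI v.isPrime v.ne_bot, h, Nat.zero_min, pow_zero,
    Ideal.one_eq_top]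

end Dedekind

variable {F : Type} [Field F] [NumberField F] (w : HeightOneSpectrum (𝓞 F))

/-! ### §1 The exponents of the norm ideal `(N𝔭_w)` and the torsor count of embeddings inducing a place -/

/-- **`ord_u (N𝔭_w) = #{g ∈ Gal(F∕ℚ) : 𝔭_{g•w} = 𝔭_u}`** (`F ∕ ℚ` Galois): `(N𝔭_w) = ∏_{g} 𝔭_{g•w}` (★ C2-arith `prod_univ_smul_asIdeal_eq_span_absNorm`) and the exponent of a
prime in a product of primes (★ p847936 §0). [cite: Shimura1998, §13.1 Thm. 1 (pp. 97–99) and (7)] -/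
theorem count_span_absNorm_eq_card_filter_smul [IsGalois ℚ F] (u : HeightOneSpectrum (𝓞 F)) :
    (Associates.mk u.asIdeal).count (Associates.mk (Ideal.span {((Ideal.absNorm w.asIdeal : ℕ) : 𝓞 F)})).factors =
      (Finset.univ.filter fun g : F ≃ₐ[ℚ] F => (g • w).asIdeal = u.asIdeal).card := by
  classical
  rw [← Literature.NumberTheory.ComplexMultiplication.prod_univ_smul_asIdeal_eq_span_absNorm w,
    count_finset_prod_asIdeal _ (fun g : F ≃ₐ[ℚ] F => g • w) u]

section Restrict

variable (τR : (F →+* AlgebraicClosure (w.adicCompletion F)) → (𝓞 F →+* ↥(closureValuationSubring (w.adicCompletion F))))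
  (hτR : ∀ (τ : F →+* AlgebraicClosure (w.adicCompletion F)) (x : 𝓞 F),
    ((τR τ x : ↥(closureValuationSubring (w.adicCompletion F))) : AlgebraicClosure (w.adicCompletion F)) = τ (x : F))

include hτR in
/-- **`#{τ : τ induces u} = #{g : 𝔭_{g•w} = 𝔭_u}`** (the torsor `τ = τ_w ∘ g`, «`τ_w ∘ g` induces `g⁻¹ • w`», then `g ↦ g⁻¹`; every fibre of `g ↦ g • w` over a conjugate of
`w` has `#Stab(w) = e_w f_w` elements). [cite: CasselsFrohlichANT1967, Ch. VII §1.1 and Prop. 1.2 (ii)] -/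
theorem card_filter_ker_eq_eq_card_filter_smul [IsGalois ℚ F] (u : HeightOneSpectrum (𝓞 F)) :
    (Finset.univ.filter fun τ : F →+* AlgebraicClosure (w.adicCompletion F) =>
        RingHom.ker ((residue ↥(closureValuationSubring (w.adicCompletion F))).comp (τR τ)) = u.asIdeal).card =
      (Finset.univ.filter fun g : F ≃ₐ[ℚ] F => (g • w).asIdeal = u.asIdeal).card := by
  classical
  rw [Finset.card_eq_sum_ones, sum_filter_embeddings_eq w, ← Finset.card_eq_sum_ones]
  refine Finset.card_equiv (Equiv.inv (F ≃ₐ[ℚ] F)) fun g => ?_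
  simp only [Finset.mem_filter, Finset.mem_univ, true_and, Equiv.inv_apply,
    ker_residue_restrict_structural_comp_algEquiv w τR hτR, HeightOneSpectrum.smul_asIdeal]

end Restrict

section Signature

variable [IsCMField F]
  (τR : (F →+* AlgebraicClosure (w.adicCompletion F)) → (𝓞 F →+* ↥(closureValuationSubring (w.adicCompletion F))))
  (hτR : ∀ (τ : F →+* AlgebraicClosure (w.adicCompletion F)) (x : 𝓞 F),
    ((τR τ x : ↥(closureValuationSubring (w.adicCompletion F))) : AlgebraicClosure (w.adicCompletion F)) = τ (x : F))
  (m : (F →+* AlgebraicClosure (w.adicCompletion F)) → ℕ)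
  (hpair : ∀ τ : F →+* AlgebraicClosure (w.adicCompletion F),
    m τ + m (τ.comp ((IsCMField.complexConj F : F ≃ₐ[↥(maximalRealSubfield F)] F) : F →+* F)) = 2)
  (hcount : ∑ τ ∈ (Finset.univ.filter fun τ : F →+* AlgebraicClosure (w.adicCompletion F) =>
      RingHom.ker ((residue ↥(closureValuationSubring (w.adicCompletion F))).comp (τR τ)) =
        (((IsCMField.complexConj F) • w).asIdeal : Ideal (𝓞 F))), m τ = 1)
  (hone : ∀ τ : F →+* AlgebraicClosure (w.adicCompletion F), m τ = 1 →
      RingHom.ker ((residue ↥(closureValuationSubring (w.adicCompletion F))).comp (τR τ)) = w.asIdeal ∨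
        RingHom.ker ((residue ↥(closureValuationSubring (w.adicCompletion F))).comp (τR τ)) = ((IsCMField.complexConj F) • w).asIdeal)

/-! ### §2 The étale bridge: `m ≡ 0` on the embeddings inducing `u` ⇒ `𝔞_can ⊔ 𝔭_u^n = ⊤` -/

include hτR in
/-- **(ÉTALE BRIDGE) `ord_u 𝔞_can = 0`** when every embedding inducing `u ≠ c•w` has `m = 0` (valuation table ★ p847936 (A5) with an empty filter).
[cite: Shimura1998, §13.1 Thm. 1 (pp. 97–99) and (7)] -/
theorem count_prod_filter_ker_eq_zero_of_forall_eq_zero [IsGalois ℚ F] (u : HeightOneSpectrum (𝓞 F)) (hu : u ≠ (IsCMField.complexConj F) • w)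
    (h0 : ∀ τ : F →+* AlgebraicClosure (w.adicCompletion F),
      RingHom.ker ((residue ↥(closureValuationSubring (w.adicCompletion F))).comp (τR τ)) = u.asIdeal → m τ = 0) :
    (Associates.mk u.asIdeal).count (Associates.mk
      (∏ τ ∈ Finset.univ.filter (fun τ : F →+* AlgebraicClosure (w.adicCompletion F) =>
          m τ ≠ 0 ∧ RingHom.ker ((residue ↥(closureValuationSubring (w.adicCompletion F))).comp (τR τ)) ≠
            (((IsCMField.complexConj F) • w).asIdeal : Ideal (𝓞 F))),
        RingHom.ker ((residue ↥(closureValuationSubring (w.adicCompletion F))).comp (τR τ)))).factors = 0 := by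
  rw [count_prod_filter_ker_eq_card_filter w τR hτR m u hu, Finset.card_eq_zero, Finset.filter_eq_empty_iff]
  exact fun τ _ h => h.1 (h0 τ h.2)

include hτR hpair hcount hone in
/-- **(ÉTALE BRIDGE) `𝔭_u^n ⊔ 𝔞_can = ⊤` for every `n`** when every embedding inducing `u ≠ c•w` has `m = 0` — the `𝔞`-hypothesis of LA4-p04՚s étale corollary of
`frobKernel_banal` (row 38). [cite: Shimura1998, §13.1 Thm. 1 (pp. 97–99) and (7)] -/
theorem pow_sup_prod_filter_ker_eq_top_of_forall_eq_zero [IsGalois ℚ F] (hw : (IsCMField.complexConj F) • w ≠ w)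
    (u : HeightOneSpectrum (𝓞 F)) (hu : u ≠ (IsCMField.complexConj F) • w)
    (h0 : ∀ τ : F →+* AlgebraicClosure (w.adicCompletion F),
      RingHom.ker ((residue ↥(closureValuationSubring (w.adicCompletion F))).comp (τR τ)) = u.asIdeal → m τ = 0) (n : ℕ) :
    u.asIdeal ^ n ⊔
      (∏ τ ∈ Finset.univ.filter (fun τ : F →+* AlgebraicClosure (w.adicCompletion F) =>
          m τ ≠ 0 ∧ RingHom.ker ((residue ↥(closureValuationSubring (w.adicCompletion F))).comp (τR τ)) ≠
            (((IsCMField.complexConj F) • w).asIdeal : Ideal (𝓞 F))),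
        RingHom.ker ((residue ↥(closureValuationSubring (w.adicCompletion F))).comp (τR τ))) = ⊤ :=
  pow_sup_eq_top_of_count_eq_zero u (prod_filter_ker_ne_bot w τR hτR m hpair hcount hone hw)
    (count_prod_filter_ker_eq_zero_of_forall_eq_zero w τR hτR m u hu h0) n

/-! ### §3 The multiplicative bridge: `m ≠ 0` on the embeddings inducing `u` ⇒ `ord_u 𝔞_can = ord_u (N𝔭_w)` and `𝔭_u^n ⊔ 𝔞_can = 𝔭_u^n ⊔ (N𝔭_w)` -/

include hτR in
/-- **(MULTIPLICATIVE BRIDGE) `ord_u 𝔞_can = ord_u (N𝔭_w)`** when every embedding inducing `u ≠ c•w` has `m ≠ 0`: both sides count the embeddings inducing `u`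
(valuation table (A5), the torsor count, and `(N𝔭_w) = ∏_{g} 𝔭_{g•w}`). [cite: Shimura1998, §13.1 Thm. 1 (pp. 97–99) and (7)] -/
theorem count_prod_filter_ker_eq_count_span_absNorm_of_forall_ne_zero [IsGalois ℚ F] (u : HeightOneSpectrum (𝓞 F))
    (hu : u ≠ (IsCMField.complexConj F) • w)
    (h2 : ∀ τ : F →+* AlgebraicClosure (w.adicCompletion F),
      RingHom.ker ((residue ↥(closureValuationSubring (w.adicCompletion F))).comp (τR τ)) = u.asIdeal → m τ ≠ 0) :
    (Associates.mk u.asIdeal).count (Associates.mk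
      (∏ τ ∈ Finset.univ.filter (fun τ : F →+* AlgebraicClosure (w.adicCompletion F) =>
          m τ ≠ 0 ∧ RingHom.ker ((residue ↥(closureValuationSubring (w.adicCompletion F))).comp (τR τ)) ≠
            (((IsCMField.complexConj F) • w).asIdeal : Ideal (𝓞 F))),
        RingHom.ker ((residue ↥(closureValuationSubring (w.adicCompletion F))).comp (τR τ)))).factors =
    (Associates.mk u.asIdeal).count (Associates.mk (Ideal.span {((Ideal.absNorm w.asIdeal : ℕ) : 𝓞 F)})).factors := by
  classical
  rw [count_prod_filter_ker_eq_card_filter w τR hτR m u hu, count_span_absNorm_eq_card_filter_smul w u,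
    ← card_filter_ker_eq_eq_card_filter_smul w τR hτR u]
  congr 1
  exact Finset.filter_congr fun τ _ => ⟨fun h => h.2, fun h => ⟨h2 τ h, h⟩⟩

include hτR hpair hcount hone in
/-- **(MULTIPLICATIVE BRIDGE) `𝔭_u^n ⊔ 𝔞_can = 𝔭_u^n ⊔ (N𝔭_w)` for every `n`** when every embedding inducing `u ≠ c•w` has `m ≠ 0` — with `N𝔭_w = p^f` (spine `hfDeg` +
★ `card_quotient_smul`) this is the `𝔞`-hypothesis `𝔞 ⊔ 𝔭_u^n = (p^f) ⊔ 𝔭_u^n` of LA4-p04՚s multiplicative corollary of `frobKernel_banal` (row 38).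
[cite: Shimura1998, §13.1 Thm. 1 (pp. 97–99) and (7)] -/
theorem pow_sup_prod_filter_ker_eq_of_forall_ne_zero [IsGalois ℚ F] (hw : (IsCMField.complexConj F) • w ≠ w)
    (u : HeightOneSpectrum (𝓞 F)) (hu : u ≠ (IsCMField.complexConj F) • w)
    (h2 : ∀ τ : F →+* AlgebraicClosure (w.adicCompletion F),
      RingHom.ker ((residue ↥(closureValuationSubring (w.adicCompletion F))).comp (τR τ)) = u.asIdeal → m τ ≠ 0) (n : ℕ) :
    u.asIdeal ^ n ⊔
      (∏ τ ∈ Finset.univ.filter (fun τ : F →+* AlgebraicClosure (w.adicCompletion F) =>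
          m τ ≠ 0 ∧ RingHom.ker ((residue ↥(closureValuationSubring (w.adicCompletion F))).comp (τR τ)) ≠
            (((IsCMField.complexConj F) • w).asIdeal : Ideal (𝓞 F))),
        RingHom.ker ((residue ↥(closureValuationSubring (w.adicCompletion F))).comp (τR τ))) =
      u.asIdeal ^ n ⊔ Ideal.span {((Ideal.absNorm w.asIdeal : ℕ) : 𝓞 F)} :=
  pow_sup_eq_pow_sup_of_count_eq u (prod_filter_ker_ne_bot w τR hτR m hpair hcount hone hw)
    (Literature.NumberTheory.NumberFields.span_natCast_ne_bot (Ideal.absNorm_eq_zero_iff.not.2 w.ne_bot))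
    (count_prod_filter_ker_eq_count_span_absNorm_of_forall_ne_zero w τR hτR m u hu h2) n

include hτR hpair hcount hone in
/-- **THE `w`-BLOCK INSTANCE: `𝔭_w^n ⊔ 𝔞_can = 𝔭_w^n ⊔ (N𝔭_w)` for every `n`** (★ p847883 (ρ7-w): `ord_w 𝔞_can = ord_w (N𝔭_w)`; no banal signature hypothesis).
[cite: Shimura1998, §13.1 Thm. 1 (pp. 97–99) and (7)] -/
theorem pow_sup_prod_filter_ker_self_eq [IsGalois ℚ F] (hw : (IsCMField.complexConj F) • w ≠ w) (n : ℕ) :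
    w.asIdeal ^ n ⊔
      (∏ τ ∈ Finset.univ.filter (fun τ : F →+* AlgebraicClosure (w.adicCompletion F) =>
          m τ ≠ 0 ∧ RingHom.ker ((residue ↥(closureValuationSubring (w.adicCompletion F))).comp (τR τ)) ≠
            (((IsCMField.complexConj F) • w).asIdeal : Ideal (𝓞 F))),
        RingHom.ker ((residue ↥(closureValuationSubring (w.adicCompletion F))).comp (τR τ))) =
      w.asIdeal ^ n ⊔ Ideal.span {((Ideal.absNorm w.asIdeal : ℕ) : 𝓞 F)} :=
  pow_sup_eq_pow_sup_of_count_eq w (prod_filter_ker_ne_bot w τR hτR m hpair hcount hone hw)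
    (Literature.NumberTheory.NumberFields.span_natCast_ne_bot (Ideal.absNorm_eq_zero_iff.not.2 w.ne_bot))
    (count_prod_filter_ker_eq_count_span_absNorm w τR hτR m hpair hcount hone hw) n

include hτR hpair hcount hone in
/-- **THE `c•w`-BLOCK INSTANCE: `𝔭_{c•w}^n ⊔ 𝔞_can = ⊤` for every `n`** (★ p847883 (ρ7-c•w): `ord_{c•w} 𝔞_can = 0`). [cite: Shimura1998, §13.1 Thm. 1 (pp. 97–99) and (7)] -/
theorem pow_complexConj_smul_sup_prod_filter_ker_eq_top [IsGalois ℚ F] (hw : (IsCMField.complexConj F) • w ≠ w) (n : ℕ) :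
    ((IsCMField.complexConj F) • w).asIdeal ^ n ⊔
      (∏ τ ∈ Finset.univ.filter (fun τ : F →+* AlgebraicClosure (w.adicCompletion F) =>
          m τ ≠ 0 ∧ RingHom.ker ((residue ↥(closureValuationSubring (w.adicCompletion F))).comp (τR τ)) ≠
            (((IsCMField.complexConj F) • w).asIdeal : Ideal (𝓞 F))),
        RingHom.ker ((residue ↥(closureValuationSubring (w.adicCompletion F))).comp (τR τ))) = ⊤ :=
  pow_sup_eq_top_of_count_eq_zero _ (prod_filter_ker_ne_bot w τR hτR m hpair hcount hone hw)
    (count_complexConj_smul_prod_filter_ker_eq_zero w τR hτR m hpair hcount hone hw) n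

/-- **`N𝔭_w = N𝔭_{c•w}` as a number** (★ `card_quotient_smul`; turns the spine՚s `hfDeg : Nat.card (𝓞 F ⧸ 𝔭_{c•w}) = p^f` into `N𝔭_w = p^f` for the right-hand
sides above). [cite: CasselsFrohlichANT1967, Ch. VII §1.1] -/
theorem absNorm_asIdeal_eq_of_card_quotient_smul {q : ℕ} (hq : Nat.card (𝓞 F ⧸ ((IsCMField.complexConj F) • w).asIdeal) = q) :
    Ideal.absNorm w.asIdeal = q := by
  rw [Ideal.absNorm_apply, Submodule.cardQuot_apply, ← HeightOneSpectrum.card_quotient_smul (IsCMField.complexConj F) w, hq]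

end Signature

end Summit.HodgeConjecture.HodgeConjecture.Theorems.F0P6aCanonicalFrobeniusIdealBanalBridges

end
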